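import Literature.AlgebraicGeometry.ModuliOfAbelianVarieties.HeckeCentralRoofOfMarkedPair
import Literature.AlgebraicGeometry.ModuliOfAbelianVarieties.SiegelAdelicMarkingStableLines
import HarnessLib

/-!
# The LINE HECKE ROOFS of a marked pair of fibres: `A_{y} —q→ B ←c— A_{y″}` through the kernel `K_β` of the `𝔭`-family, and the line `u₁(L) = K_β ∩ A_{y}[𝔭′]`

Topic `AlgebraicGeometry/ModuliOfAbelianVarieties`; namespace `Literature.AlgebraicGeometry.ModuliOfAbelianVarieties`.  THEOREMS ONLY (no definition,
no named fact, no instance, no notation, no `sorry`).  Cell `hodgecm-mathlib` (D-0151), FLOOR 0, P6 «MOD programme» (crux hLiu418 = stmt-HodgeConjecture-24832,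
`--supports`, count-neutral), EHECKE closer leaf organ **(O-R1) «lines and `t₁`-roofs at complex points»** (LA5-plan (g3) skeleton v5∕v6 `OrganER1`, conjunct (4)
of `HeckeLinesRoofsAt`), generic part — the sibling of ★ `HeckeCentralRoofOfMarkedPair` ((O-R2), A-p06 (g35)) with the CENTRAL KERNEL LAW replaced by an
arbitrary LINE LATTICE `L`; HC_CM is proved only modulo the printed citations until rung 0 closes.

THE MODULI DESCRIPTION OF THE HECKE CORRESPONDENCE `T_{𝔭,1}` AT A SPLIT PRIME ([Kottwitz1992] §5 pp. 389–391; [RapoportSmithlingZhang2020Diagonal] §4.3 (4.23)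
p. 21; [HarrisTaylorAMS2001] §III.4 pp. 108–110; [ShimuraIATAF1971] §3.2, §7.3): two complex points `pt₁`, `pt₂` of the base of a polarised abelian scheme `𝒜`
with `𝒪_F`-action `ρ` and level structure, whose fibres are MARKED (★ `SiegelAdelicMarking`) by `[J₁, r₁]`, `[J₂, r₂]` with admissible readings (ample `Θᵢ` with
`λ̄ = Λ(𝒪(Θᵢ))`, symplectic towers `Λᵢ` read adelically, unit frames `γ = 1`, action readings `Mρᵢ`), and a RATIONAL TRANSPORTER `T` (`ℂ`-linear,
`ψ_δ`-symplectic, intertwining `Mρ₁`, `Mρ₂`, with the lattice law `(T·Mρ₁ π)Λ_{r₁} ⊆ Λ_{r₂}` for `π ∈ 𝔭` and the level law) are joined by an ISOGENY ROOF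
`𝒜_{pt₁} —q→ B ←c— 𝒜_{pt₂}` over `Spec ℂ` with `ker q = K_β := ⋂_{π ∈ 𝔭} ker h_π` — the joint kernel of the `𝔭`-family of marked homomorphisms `h_π` reading
`T·Mρ₁ π` — and `ker c = 𝒜_{pt₂}[𝔭]`, with the polarisation, equivariance and level clauses (r1)–(r5) of the cell's `RoofAt`; and for the LINE LATTICE
`L = {v | (T·Mρ₁ π) v ∈ Λ_{r₂} ∀ π ∈ 𝔭, (Mρ₁ a) v ∈ Λ_{r₁} ∀ a ∈ 𝔭′}` (`= 𝔭⁻¹·T⁻¹Λ_{r₂} ⊓ 𝔭′⁻¹Λ_{r₁}`, the Hecke-neighbour lattice (L-c) moved to the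
reading) its image `u₁(L)` under the torsion parametrisation `u₁ = m₁.r` is `K_β ∩ 𝒜_{pt₁}[𝔭′]` — the reader `H_β = K_β ∩ A_y[𝔭_{c•w}]` of conjunct (4) of the
E-side `HeckeLinesRoofsAt`.

* **`exists_heckeLineRoof_of_markedReadings`** — the roof through `K_β` and the line reader: the `𝔭`-family ★ `SiegelAdelicMarking.exists_idealHomFamily_X`
  (reading `π ↦ T·Mρ₁ π`), its joint kernel ★ `exists_subgroup_forall_map_eq_one`, the line reader ★ `mem_image_r_iff_forall_map_eq_one_and_forall`, `hsim` ★
  `comp_lam_comp_dualIsogenyOver_eq_mulN_sq_of_markedReadings` at `π = p`, the Serre presentation ★ `exists_serrePresentation_of_ideal_of_natCast_mem`, the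
  middle and clauses ★ `AbelianSchemeOver.exists_roof_of_idealHomFamily_of_isAlgClosed` (kernel `K := K_β`).

References: [Kottwitz1992] R. Kottwitz, JAMS 5 (1992), §5 pp. 389–391; [RapoportSmithlingZhang2020Diagonal] M. Rapoport, B. Smithling, W. Zhang, Compos. Math. 156
(2020), §4.3 (4.23) p. 21; [HarrisTaylorAMS2001] M. Harris, R. Taylor, Ann. Math. Studies 151 (2001), §III.4 pp. 108–110; [ShimuraIATAF1971] G. Shimura,
*Introduction to the Arithmetic Theory of Automorphic Functions* (1971), §3.2, §7.3; [MumfordAV1970] D. Mumford, *Abelian Varieties* (1970), §7 Thm. 4 p. 72,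
§23 Thm. 2 p. 231; [Milne2005ShimuraVarieties] J. S. Milne, *Introduction to Shimura varieties* (2005), §6 Thm. 6.11 p. 74 and p. 75.

#harness_tags algebraic_geometry.abelian_varieties, number_theory.shimura_varieties
-/

set_option autoImplicit false

noncomputable section

-- Mathlib's `Over`/pull-back API is stated across semireducible wrappers (as in the ★ `AbelianSchemes/*` files).
set_option backward.isDefEq.respectTransparency false

open Matrix CategoryTheory CategoryTheory.Limits AlgebraicGeometry NumberField IsDedekindDomain
open scoped MonObj
open Literature.AlgebraicGeometry.Motives (AbelianVariety AlgPoints CartierDivisor)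
open Literature.AlgebraicGeometry.AbelianSchemes Literature.AlgebraicGeometry.AbelianSchemes.AbelianSchemeOver
open Literature.NumberTheory.Adeles (latticeOfGL mem_integralAdeles_of_forall_valued_eq_one)
open Literature.Geometry.Kaehler (ComplexTorus)

namespace Literature.AlgebraicGeometry.ModuliOfAbelianVarieties

variable {g : ℕ} {δ : Fin g → ℕ}

set_option maxHeartbeats 800000 in
/-- **THE LINE HECKE ROOF OF A MARKED PAIR** ([Kottwitz1992] §5; [RapoportSmithlingZhang2020Diagonal] (4.23); [HarrisTaylorAMS2001] §III.4; [ShimuraIATAF1971]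
§3.2).  Data: `(𝒜, ρ, D, λ, φ)` over `Y` with Rosati involution `c` (`hros`), relative dimension `g₀`; complex points `pt₁ pt₂`; unit-frame markings `mᵢ` of the
fibres by `[Jᵢ, rᵢ]` (`ν(rᵢ) = uᵢ` of valuation one) with admissible readings — ample `Θᵢ`, `λ̄ = Λ(𝒪(Θᵢ))`, symplectic towers `Λᵢ` read through `rᵢ`
(`hrdᵢ`), action readings `Mρᵢ` on the tori (`hactᵢ`), `Mρ₁` `ℂ`-linear (`hMJ₁`); a rational transporter `T` — invertible, `ℂ`-linear (`hTJ`), intertwining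
(`hTM`), symplectic (`hTν`), with the lattice law on `𝔭` (`hTΛ`) and the level law (`hTlvl`); ideals `𝔭`, `𝔭′ = c 𝔭`, `𝔡` with `𝔭𝔭′𝔡 = (p)`, `p ∈ 𝔭`
prime; and a LINE LATTICE `L` read by `hL : v ∈ L ↔ (∀ π ∈ 𝔭, (T·Mρ₁ π) v ∈ Λ_{r₂}) ∧ (∀ a ∈ 𝔭′, (Mρ₁ a) v ∈ Λ_{r₁})`.  CONCLUSION: a subgroup
`K_β` of `𝒜_{pt₁}(ℂ)` — the joint kernel of the `𝔭`-family `h_π` — with THE LINE READER `u₁(L) = K_β ∩ 𝒜_{pt₁}[𝔭′]`, and an isogeny roof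
`𝒜_{pt₁} —q→ B ←c′— 𝒜_{pt₂}` over `Spec ℂ` with (r1) `ker q = K_β`, (r2) `ker c′ = 𝒜_{pt₂}[𝔭]`, `c′` onto, (r3) `q^*λ_B = p·λ_{pt₁}`, `c′^*λ_B = p·λ_{pt₂}`,
(r4) `𝒪_F`-equivariance, (r5) level points correspond — conjunct (4) of the cell's `HeckeLinesRoofsAt` at `(pt₁, pt₂, K_β)` for the line `u₁(L)`.  Proof = the
★ (O-R2) sibling with `K := K_β` (★ `exists_subgroup_forall_map_eq_one`) and the reader ★ `mem_image_r_iff_forall_map_eq_one_and_forall` in place of the central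
kernel law. [cite: Kottwitz1992, §5 pp. 389–391] [cite: RapoportSmithlingZhang2020Diagonal, §4.3 (4.23) p. 21] [cite: HarrisTaylorAMS2001, §III.4, pp. 108–110]
[cite: ShimuraIATAF1971, §3.2, §7.3] [cite: MumfordAV1970, §7 Thm. 4 (p. 72), §23 Thm. 2 p. 231] [cite: Milne2005ShimuraVarieties, §6 Thm. 6.11 p. 74 and p. 75] -/
theorem exists_heckeLineRoof_of_markedReadings
    {Y : Scheme.{0}} (𝒜 : AbelianSchemeOver Y) {F : Type} [Field F] [NumberField F]
    (ρ : AbelianSchemeOver.RingAction (𝓞 F) 𝒜) (D : 𝒜.DualPair) (pol : 𝒜.Polarization D) {N : ℕ} (lvl : 𝒜.LevelStructure g N) (hN : N ≠ 0)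
    {g₀ : ℕ} (hrel : 𝒜.IsOfRelDim g₀) (c : 𝓞 F ≃+* 𝓞 F) (hcc : ∀ y, c (c y) = y)
    (hros : ∀ b : 𝓞 F, haveI := ρ.isMonHom b; ρ.i (c b) ≫ pol.lam = pol.lam ≫ DualPair.dualIsogenyOver (ρ.i b) D D)
    (pt₁ pt₂ : Spec (.of ℂ) ⟶ Y)
    {J₁ J₂ : C0pm δ} {r₁ r₂ : gspFinAdelic δ}
    (m₁ : SiegelAdelicMarking J₁ r₁ (𝒜.fibre pt₁).toAbelianVariety) (m₂ : SiegelAdelicMarking J₂ r₂ (𝒜.fibre pt₂).toAbelianVariety)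
    (hγ₁ : m₁.γ = 1) (hγ₂ : m₂.γ = 1)
    {u₁ u₂ : finAdeleQˣ} (hu₁ : ∀ v, Valued.v ((u₁ : finAdeleQ) v) = 1) (hu₂ : ∀ v, Valued.v ((u₂ : finAdeleQ) v) = 1)
    (hru₁ : IsMultiplier (typeFormOver δ finAdeleQ) (r₁ : GL (Fin g ⊕ Fin g) finAdeleQ) u₁)
    (hru₂ : IsMultiplier (typeFormOver δ finAdeleQ) (r₂ : GL (Fin g ⊕ Fin g) finAdeleQ) u₂)
    {Θ₁ : CartierDivisor (𝒜.fibre pt₁).toAbelianVariety.X.left} {Θ₂ : CartierDivisor (𝒜.fibre pt₂).toAbelianVariety.X.left}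
    (Λ₁ : lvl.SymplecticLift pt₁ Θ₁ δ) (Λ₂ : lvl.SymplecticLift pt₂ Θ₂ δ) (hamp₁ : Θ₁.IsAmple) (hamp₂ : Θ₂.IsAmple)
    (hΘ₁ : 𝒜.IsLambdaOfAt pt₁ D pol.lam Θ₁) (hΘ₂ : 𝒜.IsLambdaOfAt pt₂ D pol.lam Θ₂)
    (hrd₁ : ∀ ⦃M : ℕ⦄, N ∣ M → M ≠ 0 → ∀ (y' : Fin g ⊕ Fin g → ZMod M) (w : Fin g ⊕ Fin g → ℚ),
      AdelicCongr (((r₁⁻¹ : gspFinAdelic δ)) : GL (Fin g ⊕ Fin g) finAdeleQ) 1 w (fun i => ((y' i).val : ℚ) / M) →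
        ((Λ₁.lift M (Multiplicative.ofAdd y')) : (𝒜.fibre pt₁).toAbelianVariety.Points ℂ) = m₁.r w)
    (hrd₂ : ∀ ⦃M : ℕ⦄, N ∣ M → M ≠ 0 → ∀ (y' : Fin g ⊕ Fin g → ZMod M) (w : Fin g ⊕ Fin g → ℚ),
      AdelicCongr (((r₂⁻¹ : gspFinAdelic δ)) : GL (Fin g ⊕ Fin g) finAdeleQ) 1 w (fun i => ((y' i).val : ℚ) / M) →
        ((Λ₂.lift M (Multiplicative.ofAdd y')) : (𝒜.fibre pt₂).toAbelianVariety.Points ℂ) = m₂.r w)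
    (Mρ₁ Mρ₂ : 𝓞 F →+* Matrix (Fin g ⊕ Fin g) (Fin g ⊕ Fin g) ℤ)
    (hact₁ : ∀ (b : 𝓞 F) (s : ComplexTorus m₁.Ψ), haveI := ρ.isMonHom b
      AlgPoints.map (fibreHom (ρ.i b) pt₁).hom.hom.hom (m₁.toFun s) = m₁.toFun (ComplexTorus.mapMatrix m₁.Ψ m₁.Ψ (Mρ₁ b) s))
    (hact₂ : ∀ (b : 𝓞 F) (s : ComplexTorus m₂.Ψ), haveI := ρ.isMonHom b
      AlgPoints.map (fibreHom (ρ.i b) pt₂).hom.hom.hom (m₂.toFun s) = m₂.toFun (ComplexTorus.mapMatrix m₂.Ψ m₂.Ψ (Mρ₂ b) s))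
    (hMJ₁ : ∀ b : 𝓞 F, (Mρ₁ b).map (Int.cast : ℤ → ℝ) * (J₁ : Matrix (Fin g ⊕ Fin g) (Fin g ⊕ Fin g) ℝ) =
      (J₁ : Matrix (Fin g ⊕ Fin g) (Fin g ⊕ Fin g) ℝ) * (Mρ₁ b).map (Int.cast : ℤ → ℝ))
    (T : Matrix (Fin g ⊕ Fin g) (Fin g ⊕ Fin g) ℚ) (hTu : IsUnit T)
    (hTJ : T.map (algebraMap ℚ ℝ) * (J₁ : Matrix (Fin g ⊕ Fin g) (Fin g ⊕ Fin g) ℝ) = (J₂ : Matrix (Fin g ⊕ Fin g) (Fin g ⊕ Fin g) ℝ) * T.map (algebraMap ℚ ℝ))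
    (hTM : ∀ b : 𝓞 F, T * (Mρ₁ b).map (Int.cast : ℤ → ℚ) = (Mρ₂ b).map (Int.cast : ℤ → ℚ) * T)
    (hTν : Tᵀ * (typeForm δ).map (Int.cast : ℤ → ℚ) * T = (typeForm δ).map (Int.cast : ℤ → ℚ))
    (𝔭 𝔭' 𝔡 : Ideal (𝓞 F)) (h𝔭c : 𝔭.map (c : 𝓞 F →+* 𝓞 F) = 𝔭') {p : ℕ} (hp : p.Prime) (hp𝔭 : (p : 𝓞 F) ∈ 𝔭) (h𝔭0 : 𝔭 ≠ ⊥)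
    (hpd : 𝔭 * 𝔭' * 𝔡 = Ideal.span {(p : 𝓞 F)})
    (hTΛ : ∀ π ∈ 𝔭, ∀ z ∈ latticeOfGL ((r₁ : gspFinAdelic δ) : GL (Fin g ⊕ Fin g) finAdeleQ),
      (T * (Mρ₁ π).map (Int.cast : ℤ → ℚ)) *ᵥ z ∈ latticeOfGL ((r₂ : gspFinAdelic δ) : GL (Fin g ⊕ Fin g) finAdeleQ))
    (hTlvl : ∀ (y' : Fin g ⊕ Fin g → ZMod N) (w₁ w₂ : Fin g ⊕ Fin g → ℚ),
      AdelicCongr (((r₁⁻¹ : gspFinAdelic δ)) : GL (Fin g ⊕ Fin g) finAdeleQ) 1 w₁ (fun i => ((y' i).val : ℚ) / N) →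
      AdelicCongr (((r₂⁻¹ : gspFinAdelic δ)) : GL (Fin g ⊕ Fin g) finAdeleQ) 1 w₂ (fun i => ((y' i).val : ℚ) / N) →
      ∀ π ∈ 𝔭, (T * (Mρ₁ π).map (Int.cast : ℤ → ℚ)) *ᵥ w₁ - ((Mρ₂ π).map (Int.cast : ℤ → ℚ)) *ᵥ w₂ ∈
        latticeOfGL ((r₂ : gspFinAdelic δ) : GL (Fin g ⊕ Fin g) finAdeleQ))
    (L : Submodule ℤ (Fin g ⊕ Fin g → ℚ))
    (hL : ∀ v : Fin g ⊕ Fin g → ℚ, v ∈ L ↔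
      (∀ π ∈ 𝔭, (T * (Mρ₁ π).map (Int.cast : ℤ → ℚ)) *ᵥ v ∈ latticeOfGL ((r₂ : gspFinAdelic δ) : GL (Fin g ⊕ Fin g) finAdeleQ)) ∧
      (∀ a ∈ 𝔭', ((Mρ₁ a).map (Int.cast : ℤ → ℚ)) *ᵥ v ∈ latticeOfGL ((r₁ : gspFinAdelic δ) : GL (Fin g ⊕ Fin g) finAdeleQ))) :
    ∃ Kβ : Subgroup ((𝒜.fibre pt₁).toAbelianVariety.Points ℂ),
      (∀ P, P ∈ m₁.r '' (L : Set (Fin g ⊕ Fin g → ℚ)) ↔ P ∈ Kβ ∧ ∀ a ∈ 𝔭', haveI := ρ.isMonHom a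
        (AlgPoints.map (fibreHom (ρ.i a) pt₁).hom.hom.hom P : (𝒜.fibre pt₁).toAbelianVariety.Points ℂ) = 1) ∧
      ∃ (B : AbelianSchemeOver (Spec (.of ℂ))) (DB : B.DualPair) (lamB : B.X ⟶ DB.hat.X) (_ : IsMonHom lamB)
        (_ : Nonempty ((Scheme.Modules.pullback DB.unitHatSlice).obj DB.P ≅ SheafOfModules.unit _))
        (q : (𝒜.baseChange pt₁).X ⟶ B.X) (_ : IsMonHom q) (c' : (𝒜.baseChange pt₂).X ⟶ B.X) (_ : IsMonHom c'),
        (∀ P : (𝒜.fibre pt₁).toAbelianVariety.Points ℂ, (AlgPoints.map q P : B.toAffine.toAbelianVariety.Points ℂ) = 1 ↔ P ∈ Kβ) ∧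
        (∀ P : (𝒜.fibre pt₂).toAbelianVariety.Points ℂ, (AlgPoints.map c' P : B.toAffine.toAbelianVariety.Points ℂ) = 1 ↔
          ∀ a ∈ 𝔭, haveI := ρ.isMonHom a
            (AlgPoints.map (fibreHom (ρ.i a) pt₂).hom.hom.hom P : (𝒜.fibre pt₂).toAbelianVariety.Points ℂ) = 1) ∧
        Function.Surjective c'.left.base ∧
        (haveI := (pol.baseChange pt₁).isMonHom
         q ≫ lamB ≫ DualPair.dualIsogenyOver q (D.baseChange pt₁) DB = (pol.baseChange pt₁).lam ≫ (D.baseChange pt₁).hat.mulN p) ∧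
        (haveI := (pol.baseChange pt₂).isMonHom
         c' ≫ lamB ≫ DualPair.dualIsogenyOver c' (D.baseChange pt₂) DB = (pol.baseChange pt₂).lam ≫ (D.baseChange pt₂).hat.mulN p) ∧
        (∀ a : 𝓞 F, ∃ b : B.X ⟶ B.X, haveI := ρ.isMonHom a
          (fibreHom (ρ.i a) pt₁).hom.hom.hom ≫ q = q ≫ b ∧ (fibreHom (ρ.i a) pt₂).hom.hom.hom ≫ c' = c' ≫ b) ∧
        (∀ a : Fin g ⊕ Fin g → ZMod N, (AlgPoints.map q (𝒜.restrictPt pt₁ (lvl.section_ a)) : B.toAffine.toAbelianVariety.Points ℂ) =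
          AlgPoints.map c' (𝒜.restrictPt pt₂ (lvl.section_ a))) := by
  classical
  haveI := (pol.baseChange pt₁).isMonHom
  haveI := (pol.baseChange pt₂).isMonHom
  haveI : NeZero N := ⟨hN⟩
  haveI : IsCommMonObj (𝒜.baseChange pt₂).X := (𝒜.baseChange pt₂).isCommMonObj_of_isReduced_base
  have hpQ : (p : ℚ) ≠ 0 := Nat.cast_ne_zero.2 hp.ne_zero
  -- `p ∈ 𝔭′ = c 𝔭`
  have hp𝔭' : (p : 𝓞 F) ∈ 𝔭' := by
    rw [← h𝔭c, ← map_natCast (c : 𝓞 F →+* 𝓞 F) p]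
    exact Ideal.mem_map_of_mem _ hp𝔭
  -- `(Mρ₁ p)_ℚ = p·1` and `T·(Mρ₁ p)_ℚ = p·T`
  have hMp : (Mρ₁ (p : 𝓞 F)).map (Int.cast : ℤ → ℚ) = (p : ℚ) • (1 : Matrix (Fin g ⊕ Fin g) (Fin g ⊕ Fin g) ℚ) := by
    rw [map_natCast]
    ext i j
    rw [Matrix.map_apply, Matrix.natCast_apply, Matrix.smul_apply, Matrix.one_apply]
    split_ifs <;> simp
  have hTMp : T * (Mρ₁ (p : 𝓞 F)).map (Int.cast : ℤ → ℚ) = (p : ℚ) • T := by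
    rw [hMp, Matrix.mul_smul, Matrix.mul_one]
  -- the two action families on the fibres and their torsion readings
  let ι₁ : 𝓞 F → ((𝒜.fibre pt₁).toAbelianVariety ⟶ (𝒜.fibre pt₁).toAbelianVariety) := fun b =>
    haveI := ρ.isMonHom b
    fibreHom (ρ.i b) pt₁
  let ι₂ : 𝓞 F → ((𝒜.fibre pt₂).toAbelianVariety ⟶ (𝒜.fibre pt₂).toAbelianVariety) := fun b =>
    haveI := ρ.isMonHom b
    fibreHom (ρ.i b) pt₂
  have hι₁ : ∀ (b : 𝓞 F) (v : Fin g ⊕ Fin g → ℚ),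
      AlgPoints.map (ι₁ b).hom.hom.hom (m₁.r v) = m₁.r ((Mρ₁ b).map (Int.cast : ℤ → ℚ) *ᵥ v) := fun b v =>
    m₁.map_r_eq_of_map_toFun_mapMatrix hγ₁ (ι₁ b) (Mρ₁ b) (hact₁ b) v
  have hι₂ : ∀ (b : 𝓞 F) (v : Fin g ⊕ Fin g → ℚ),
      AlgPoints.map (ι₂ b).hom.hom.hom (m₂.r v) = m₂.r ((Mρ₂ b).map (Int.cast : ℤ → ℚ) *ᵥ v) := fun b v =>
    m₂.map_r_eq_of_map_toFun_mapMatrix hγ₂ (ι₂ b) (Mρ₂ b) (hact₂ b) v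
  -- (O-HF) the `𝔭`-family of marked homomorphisms
  obtain ⟨hf, hread, hmon, hadd, hlin, heq⟩ :=
    SiegelAdelicMarking.exists_idealHomFamily_X m₁ m₂ 𝔭 ι₁ Mρ₁ hι₁ ι₂ Mρ₂ hι₂ T hTJ hTM hMJ₁ hTΛ
  -- the invertible readings `p·T` of `h_p` and `p·1` of `ι₁ p`
  obtain ⟨Tu, hTu'⟩ := hTu
  let q₀ : GL (Fin g ⊕ Fin g) ℚ := Units.map (Matrix.scalar (Fin g ⊕ Fin g)).toMonoidHom (Units.mk0 (p : ℚ) hpQ) * Tu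
  have hq₀ : ((q₀ : GL (Fin g ⊕ Fin g) ℚ) : Matrix (Fin g ⊕ Fin g) (Fin g ⊕ Fin g) ℚ) = T * (Mρ₁ (p : 𝓞 F)).map (Int.cast : ℤ → ℚ) := by
    rw [hTMp]
    change Matrix.scalar (Fin g ⊕ Fin g) (p : ℚ) * (Tu : Matrix (Fin g ⊕ Fin g) (Fin g ⊕ Fin g) ℚ) = _
    rw [hTu', Matrix.scalar_apply, ← Matrix.smul_eq_diagonal_mul]
  let q₁ : GL (Fin g ⊕ Fin g) ℚ := Units.map (Matrix.scalar (Fin g ⊕ Fin g)).toMonoidHom (Units.mk0 (p : ℚ) hpQ)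
  have hq₁ : ((q₁ : GL (Fin g ⊕ Fin g) ℚ) : Matrix (Fin g ⊕ Fin g) (Fin g ⊕ Fin g) ℚ) = (Mρ₁ (p : 𝓞 F)).map (Int.cast : ℤ → ℚ) := by
    rw [hMp]
    change Matrix.scalar (Fin g ⊕ Fin g) (p : ℚ) = _
    rw [Matrix.scalar_apply, Matrix.smul_one_eq_diagonal]
  -- THE KERNEL `K_β = ⋂_{π ∈ 𝔭} Ker h_π` of the family
  obtain ⟨Kβ, hK⟩ := SiegelAdelicMarking.exists_subgroup_forall_map_eq_one (A := (𝒜.fibre pt₁).toAbelianVariety) (𝔭 : Set (𝓞 F)) hf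
  simp only [SetLike.mem_coe] at hK
  -- THE LINE READER `u₁(L) = K_β ∩ 𝒜_{pt₁}[𝔭′]`
  have hline : ∀ P, P ∈ m₁.r '' (L : Set (Fin g ⊕ Fin g → ℚ)) ↔
      P ∈ Kβ ∧ ∀ a ∈ 𝔭', (AlgPoints.map (ι₁ a).hom.hom.hom P : (𝒜.fibre pt₁).toAbelianVariety.Points ℂ) = 1 := by
    intro P
    have r := SiegelAdelicMarking.mem_image_r_iff_forall_map_eq_one_and_forall m₁ m₂ (𝔭 : Set (𝓞 F)) hf
      (fun π => T * (Mρ₁ π).map (Int.cast : ℤ → ℚ)) hread hp𝔭 q₀ hq₀ (𝔭' : Set (𝓞 F)) ι₁ (fun a => (Mρ₁ a).map (Int.cast : ℤ → ℚ))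
      (fun a _ v => hι₁ a v) (L := L) (fun v => by simpa only [SetLike.mem_coe] using hL v) P
    simp only [SetLike.mem_coe] at r
    rw [r, hK P]
  -- `hsim` at `π = p`
  have hreadp : ∀ v, AlgPoints.map (hf (p : 𝓞 F)).hom.hom.hom (m₁.r v) = m₂.r (((p : ℚ) • T) *ᵥ v) := fun v => by
    rw [hread (p : 𝓞 F) hp𝔭 v, hTMp]
  have hTΛp : ∀ v ∈ latticeOfGL ((r₁ : gspFinAdelic δ) : GL (Fin g ⊕ Fin g) finAdeleQ),
      ((p : ℚ) • T) *ᵥ v ∈ latticeOfGL ((r₂ : gspFinAdelic δ) : GL (Fin g ⊕ Fin g) finAdeleQ) := fun v hv => by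
    rw [← hTMp]
    exact hTΛ (p : 𝓞 F) hp𝔭 v hv
  have hsim := comp_lam_comp_dualIsogenyOver_eq_mulN_sq_of_markedReadings 𝒜 D pol lvl hN pt₁ pt₂ m₁ m₂ hu₁ hu₂ hru₁ hru₂ Λ₁ Λ₂ hamp₁ hamp₂ hΘ₁ hΘ₂
    hrd₁ hrd₂ T ⟨Tu, hTu'⟩ hTν hp.ne_zero hTΛp (hf (p : 𝓞 F)) hreadp
  -- the level law through the towers at `M = N`
  have hlvl : ∀ (a : Fin g ⊕ Fin g → ZMod N), ∀ π ∈ 𝔭,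
      (AlgPoints.map (hf π).hom.hom.hom (𝒜.restrictPt pt₁ (lvl.section_ a)) : (𝒜.baseChange pt₂).toAffine.toAbelianVariety.Points ℂ) =
        AlgPoints.map ((ρ.baseChange pt₂).i π) (𝒜.restrictPt pt₂ (lvl.section_ a)) := by
    intro a π hπ
    obtain ⟨w₁, hw₁⟩ := SiegelAdelicMarking.exists_adelicCongr_inv_one (a := r₁) (fun i => ((a i).val : ℚ) / N)
    obtain ⟨w₂, hw₂⟩ := SiegelAdelicMarking.exists_adelicCongr_inv_one (a := r₂) (fun i => ((a i).val : ℚ) / N)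
    have e₁ : 𝒜.restrictPt pt₁ (lvl.section_ a) = m₁.r w₁ := by
      rw [← Λ₁.coe_lift_ofAdd_eq_restrictPt_section]; exact hrd₁ dvd_rfl hN a w₁ hw₁
    have e₂ : 𝒜.restrictPt pt₂ (lvl.section_ a) = m₂.r w₂ := by
      rw [← Λ₂.coe_lift_ofAdd_eq_restrictPt_section]; exact hrd₂ dvd_rfl hN a w₂ hw₂
    rw [e₁, e₂, hread π hπ w₁]
    change _ = AlgPoints.map (ι₂ π).hom.hom.hom (m₂.r w₂)
    rw [hι₂ π w₂, SiegelAdelicMarking.r_eq_r_iff_sub_mem_latticeOfGL]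
    exact hTlvl a w₁ w₂ hw₁ hw₂ π hπ
  -- the Serre presentation of `𝔭`
  obtain ⟨mS, E', hE', P, Q, hP, hQ, hQP, hPQ, h𝔭gen, -, -⟩ :=
    Literature.NumberTheory.NumberFields.SerrePresentation.exists_serrePresentation_of_ideal_of_natCast_mem 𝔭 h𝔭0 hp𝔭
  -- Rosati on the fibre, character, `𝔭·c𝔭·𝔡 = (p)`
  have hros' : ∀ b : 𝓞 F, haveI := (ρ.baseChange pt₂).isMonHom b
      (ρ.baseChange pt₂).i (c b) ≫ (pol.baseChange pt₂).lam =
        (pol.baseChange pt₂).lam ≫ DualPair.dualIsogenyOver ((ρ.baseChange pt₂).i b) (D.baseChange pt₂) (D.baseChange pt₂) := fun b =>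
    RingAction.rosati_baseChange pt₂ ρ D pol.lam b (c b) (hros b)
  have hchar : ∀ l : ℕ, l.Prime → (l : ℂ) = 0 → l ∣ 1 := fun l hl h0 => absurd h0 (Nat.cast_ne_zero.2 hl.ne_zero)
  have hpd' : 𝔭 * 𝔭.map (c : 𝓞 F →+* 𝓞 F) * 𝔡 = Ideal.span {((p : ℕ) : 𝓞 F)} := by rw [h𝔭c]; exact hpd
  -- THE ROOF
  obtain ⟨B, DB, lamB, hlamB, hDB, q, hq, c', hc', hr1, hr2, hsurj, hr3q, hr3c, hr4, hr5⟩ :=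
    exists_roof_of_idealHomFamily_of_isAlgClosed (A₁ := 𝒜.baseChange pt₁) (A₂ := 𝒜.baseChange pt₂)
      (fun a => (ι₁ a).hom.hom.hom) (ρ.baseChange pt₂) c (fun π => (hf π).hom.hom.hom) E' hE' P Q
      (D.baseChange pt₁) (D.baseChange pt₂) (pol.baseChange pt₁).nonempty_unitHatSlice_iso (pol.baseChange pt₂).nonempty_unitHatSlice_iso
      (pol.baseChange pt₁).lam (pol.baseChange pt₂).lam
      (fun a : Fin g ⊕ Fin g → ZMod N => 𝒜.restrictPt pt₁ (lvl.section_ a)) (fun a => 𝒜.restrictPt pt₂ (lvl.section_ a))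
      (fun Pt => ∀ a ∈ 𝔭, (AlgPoints.map (ι₂ a).hom.hom.hom Pt : (𝒜.fibre pt₂).toAbelianVariety.Points ℂ) = 1) Kβ
      (hrel.baseChange pt₂) (fun Ω' _ _ s => (pol.baseChange pt₂).exists_ample Ω' s) hcc hros' h𝔭0 one_ne_zero hchar 𝔡 hpd'
      hp.ne_zero hP hQ hQP hPQ h𝔭gen hmon hadd hlin heq hsim hlvl hK (fun Pt => Iff.rfl)
  exact ⟨Kβ, hline, B, DB, lamB, hlamB, hDB, q, hq, c', hc', hr1, hr2, hsurj, hr3q, hr3c, hr4, hr5⟩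

end Literature.AlgebraicGeometry.ModuliOfAbelianVarieties

end
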